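import Summits.BirchSwinnertonDyer.Rank1Residual.GaloisImage.CongruenceVisibilityIdentityComponentIndexRat
import Summits.BirchSwinnertonDyer.Rank1Residual.X11b.VisibilityRankOne
import HarnessLib

/-!
# Rank ONE: `BSD(E,3)` from Kolyvagin's index bound (UPPER) and THEOREM B's visible `Ш(E)[3] ≠ 0`
# at additive `3`, σ = E0/E0 (LOWER) (cell `b2b-bsdres`, team n1011, seat p10 GEN 9;
# ROW T-VIS3-UC-IOTA FILE 8; skeleton `cells/n1011/skel/T-VIS3-UC-IOTA.md`)

HONEST FRAMING (cell `b2b-bsdres`, run/shared/lean/b2b/bsd-rank1-residual/, verbatim in every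
file): the goal of the cell is to DELETE the COMBINATION-SHAPED residual classes of the
Birch–Swinnerton-Dyer formula for ALL analytic-rank `≤ 1` elliptic curves over `ℚ` — "full BSD
formula for every rank `≤ 1` curve in class `C`" assembled STRICTLY from published theorems — so
that the rank-`≤ 1` remainder becomes exactly the CONSTRUCTION-SHAPED classes, which are TYPED
(missing-input `Prop`s), NOT attempted. This is not "finishing BSD". Team n1011 (N10 / N11):
research route on the CONSTRUCTION-SHAPED class X4, here its analytic-rank-ONE part at `3` (§I O7);
no claim beyond the stated classes; nothing is booked; no mark / label / count moved. Theorems only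
(no definition, no named fact, no `sorry`). A PER-PAIR certificate SHAPE, conditional on the displayed
PUBLISHED facts (`kolyvagin`, `Kolyvagin1990_padicValNat_card_sha_le`, Cassels–Tate, GZK) and on
per-pair data (Heegner datum with its index, the partner, `θ`, the local data); closes nothing by
itself; any row count is route planner 1's (EVIDENCE).

## What

n1011's unit x11c proved `X11b.bsdp_of_kolyvagin_of_congr` (`X11b/VisibilityRankOne.lean`): at a pair
of analytic rank `1`, `p` odd, `ρ̄_{E,p}` onto, `ord_p #Ш_an = 2`, a Heegner datum with
`ord_p [E(K):ℤP] ≤ 1` gives the UPPER half (Kolyvagin) and a `p`-congruent curve of rank `≥ 3` with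
`E′(ℚ_v)[p] = 0` at EVERY place of `S` gives the LOWER half (the crude visibility count). At `p = 3`
with both curves ADDITIVE at `3` and `#E(ℚ₃)[3] = #E′(ℚ₃)[3] = 3` the crude count fails at the place `3`;
THEOREM B in the comparison-index currency (FILE 1b: σ = E0 on both curves ⇒ `ι₃(θ) ≤ 3`) repairs it:
`[E(ℚ):3E(ℚ)] · ι₃ ≤ 3 · 3 = 9 < 27 ≤ [E′(ℚ):3E′(ℚ)]` (FILE 3's `…_of_index_le_three_rat`;
`[E(ℚ):3E(ℚ)] = 3^{rank}·#E(ℚ)[3] = 3` by x11c's `index_range_zsmul_eq_pow_rank_mul_card_torsionBy` and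
irreducibility). This file is that END:
`bsdp_three_of_kolyvagin_of_congr_of_identityComponent` — `X11b.bsdp_of_kolyvagin_of_congr` at `p = 3`
with `hloc` REPLACED by `hoff` (ι_v(θ) = 1 at the places `v ≠ 3` of `S`, the free kinds) + the place-`3`
data of THEOREM B (`hcard hcard′` and the two identity-component data, T-LOC3T / T-SIG3-TRI deciders).
References: [McCallumLMS1991] §1; [GrossLMS1991] Thm. 1.3; [CremonaMazur2000] §3; [AgasheStein2002]
Thm. 3.1; [MilneADT2006] I.3.3, I.3.8; [SilvermanAEC2009] VIII.6.7, X.4.14; [Miller2011LMS] Def. 1.1;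
L41-NOTE §§1–2 (`HOME/b2b-bsdres-n1011-p10/g8/`). -/

noncomputable section

open scoped Classical

namespace Summit.BirchSwinnertonDyer.Rank1Residual.GaloisImage.TwistedWitness

open WeierstrassCurve Literature.NumberTheory.EllipticCurves Literature.NumberTheory.GaloisRepresentations
  Literature.NumberTheory.EllipticCurves.Rank1Residual
  Literature.NumberTheory.EllipticCurves.Rank1Residual.Typed
open Field NumberField IsDedekindDomain IsDedekindDomain.HeightOneSpectrum Rat.HeightOneSpectrum
  Summit.BirchSwinnertonDyer.Rank1Residual.X11b

/-- **Rank one at `3`, `ρ̄_{E,3}` onto, `ord₃ #Ш_an = 2`: `BSD(E,3)` from PUBLISHED theorems plus the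
per-pair certificates — Kolyvagin's Heegner datum with `ord₃ [E(K) : ℤP] ≤ 1` (UPPER half), and a
`3`-congruent curve of rank `≥ 3` with σ = E0 on BOTH curves at the additive place `3`
(`#E(ℚ₃)[3] = #E′(ℚ₃)[3] = 3`, cuspidal integral models with identity-component `3`-torsion points)
and the local conditions agreeing along `θ` at every other place of `S` (LOWER half: THEOREM B in the
comparison-index currency + Cassels–Tate).** Binders as `X11b.bsdp_of_kolyvagin_of_congr` with `hloc`
replaced by `(v₀ hv₀ hoff hcard hcard′ M … h3 M′ … h3′)`. NOT a class theorem; closes nothing beyond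
its displayed binders. [cite: McCallumLMS1991, §1 Theorem (Kolyvagin), p. 296]
[cite: SilvermanAEC2009, Thm. X.4.14] [cite: CremonaMazur2000, §3 and Table 1]
[cite: MilneADT2006, Ch. I Prop. 3.8 and Lemma 3.3] [cite: Miller2011LMS, §1 and Def. 1.1] -/
theorem bsdp_three_of_kolyvagin_of_congr_of_identityComponent (W : WeierstrassCurve ℚ) [W.IsElliptic]
    (hCT : exists_casselsTate_pairing (K := ℚ))
    (hGZK : rank_eq_analyticRank_of_analyticRank_le_one)
    {N : ℕ} [NeZero N] {K : Type} [Field K] [NumberField K] (hKo : kolyvagin N W K)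
    (hB : Kolyvagin1990_padicValNat_card_sha_le N W K) (hK : IsImaginaryQuadratic K)
    (hH : SatisfiesHeegnerHypothesis N K) {P : (W.baseChange K).toAffine.Point}
    (hP : IsHeegnerPoint N W K P) (hnt : ¬ IsOfFinAddOrder P)
    (hρ : W.HasSurjectiveModNGaloisRep 3)
    (hI : padicValNat 3 (AddSubgroup.zmultiples P).index ≤ 1)
    (hr : W.analyticRank = 1) {s : ℚ} (hs : shaAn W = (s : ℂ)) (hv : padicValRat 3 s = 2)
    (W' : WeierstrassCurve ℚ) [W'.IsElliptic]
    (θ : geomTorsion W' ((3 : ℕ) : ℤ) ≃+ geomTorsion W ((3 : ℕ) : ℤ))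
    (hθ : ∀ (σ : absoluteGaloisGroup ℚ) (P : geomTorsion W' ((3 : ℕ) : ℤ)), θ (σ • P) = σ • θ P)
    (hrank : 3 ≤ W'.mordellWeilRank) (S : Finset (HeightOneSpectrum (𝓞 ℚ)))
    (hS : ∀ v : HeightOneSpectrum (𝓞 ℚ), v ∉ S →
      W.HasGoodReductionAt v ∧ W'.HasGoodReductionAt v ∧ ((3 : ℕ) : 𝓞 ℚ) ∉ v.asIdeal)
    (v₀ : HeightOneSpectrum (𝓞 ℚ)) (hv₀ : (primesEquiv v₀ : ℕ) = 3)
    (hoff : ∀ v ∈ S, v ≠ v₀ →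
      (selmerLocalKer W (v.adicCompletion ℚ) ((3 : ℕ) : ℤ)).relIndex
        ((selmerLocalKer W' (v.adicCompletion ℚ) ((3 : ℕ) : ℤ)).map (h1Equiv θ hθ).toAddMonoidHom) = 1)
    (hcard : Nat.card (nsmulAddMonoidHom 3 :
      (W.baseChange (v₀.adicCompletion ℚ)).toAffine.Point →+ _).ker = 3)
    (hcard' : Nat.card (nsmulAddMonoidHom 3 :
      (W'.baseChange (v₀.adicCompletion ℚ)).toAffine.Point →+ _).ker = 3)
    (M : WeierstrassCurve (v₀.adicCompletionIntegers ℚ)) (C : VariableChange (v₀.adicCompletion ℚ))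
    (hC : C • W.baseChange (v₀.adicCompletion ℚ) =
      M.map (algebraMap (v₀.adicCompletionIntegers ℚ) (v₀.adicCompletion ℚ)))
    (x₀ y₀ a : IsLocalRing.ResidueField (v₀.adicCompletionIntegers ℚ))
    (hcusp : M.map (IsLocalRing.residue (v₀.adicCompletionIntegers ℚ)) = singularModel x₀ y₀ a a)
    {a₀ b₀ : v₀.adicCompletionIntegers ℚ}
    (hns₀ : (M.map (IsLocalRing.residue (v₀.adicCompletionIntegers ℚ))).toAffine.Nonsingular
      (IsLocalRing.residue (v₀.adicCompletionIntegers ℚ) a₀)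
      (IsLocalRing.residue (v₀.adicCompletionIntegers ℚ) b₀))
    (hm : ((M.map (algebraMap (v₀.adicCompletionIntegers ℚ) (v₀.adicCompletion ℚ))).baseChange
        (AlgebraicClosure (v₀.adicCompletion ℚ))).toAffine.Nonsingular
      (algebraMap (v₀.adicCompletionIntegers ℚ) (AlgebraicClosure (v₀.adicCompletion ℚ)) a₀)
      (algebraMap (v₀.adicCompletionIntegers ℚ) (AlgebraicClosure (v₀.adicCompletion ℚ)) b₀))
    (h3 : (3 : ℤ) • (Affine.Point.some _ _ hm :
      ((M.map (algebraMap (v₀.adicCompletionIntegers ℚ) (v₀.adicCompletion ℚ))).baseChange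
        (AlgebraicClosure (v₀.adicCompletion ℚ))).toAffine.Point) = 0)
    (M' : WeierstrassCurve (v₀.adicCompletionIntegers ℚ)) (C' : VariableChange (v₀.adicCompletion ℚ))
    (hC' : C' • W'.baseChange (v₀.adicCompletion ℚ) =
      M'.map (algebraMap (v₀.adicCompletionIntegers ℚ) (v₀.adicCompletion ℚ)))
    (x₀' y₀' a' : IsLocalRing.ResidueField (v₀.adicCompletionIntegers ℚ))
    (hcusp' : M'.map (IsLocalRing.residue (v₀.adicCompletionIntegers ℚ)) = singularModel x₀' y₀' a' a')
    {a₀' b₀' : v₀.adicCompletionIntegers ℚ}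
    (hns₀' : (M'.map (IsLocalRing.residue (v₀.adicCompletionIntegers ℚ))).toAffine.Nonsingular
      (IsLocalRing.residue (v₀.adicCompletionIntegers ℚ) a₀')
      (IsLocalRing.residue (v₀.adicCompletionIntegers ℚ) b₀'))
    (hm' : ((M'.map (algebraMap (v₀.adicCompletionIntegers ℚ) (v₀.adicCompletion ℚ))).baseChange
        (AlgebraicClosure (v₀.adicCompletion ℚ))).toAffine.Nonsingular
      (algebraMap (v₀.adicCompletionIntegers ℚ) (AlgebraicClosure (v₀.adicCompletion ℚ)) a₀')
      (algebraMap (v₀.adicCompletionIntegers ℚ) (AlgebraicClosure (v₀.adicCompletion ℚ)) b₀'))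
    (h3' : (3 : ℤ) • (Affine.Point.some _ _ hm' :
      ((M'.map (algebraMap (v₀.adicCompletionIntegers ℚ) (v₀.adicCompletion ℚ))).baseChange
        (AlgebraicClosure (v₀.adicCompletion ℚ))).toAffine.Point) = 0) :
    haveI : Fact (Nat.Prime 3) := ⟨Nat.prime_three⟩
    BSDp W 3 := by
  haveI : Fact (Nat.Prime 3) := ⟨Nat.prime_three⟩
  obtain ⟨hrk, hfin⟩ := hGZK W (by omega)
  have hirr : Irr W 3 := hasIrreducibleModPGaloisRep_of_hasSurjectiveModNGaloisRep W 3 hρ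
  -- `[E(ℚ):3E(ℚ)] = 3^{rank E}·#E(ℚ)[3] = 3` (rank one, no rational `3`-torsion by irreducibility)
  have hidx := index_range_zsmul_eq_pow_rank_mul_card_torsionBy W (n := 3) (by norm_num)
  rw [hrk, hr, pow_one, (natCard_torsionBy_point_eq_of_subsingleton W _ _ _).trans
    (natCard_torsionBy_eq_one_of_hasIrreducibleModPGaloisRep W 3 hirr), mul_one] at hidx
  -- (`ℚ`'s decidable equality vs the classical one of the general lemma: `Subsingleton (DecidableEq ℚ)`)
  have hidxE : (zsmulAddGroupHom ((3 : ℕ) : ℤ) : W.toAffine.Point →+ W.toAffine.Point).range.index ≤ 3 := by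
    refine le_of_eq ?_
    convert hidx
  -- LOWER half: THEOREM B's visible element (ι₃(θ) ≤ 3), then Cassels–Tate squareness
  have hdvd : 3 ∣ W.shaOrder :=
    dvd_shaOrder_of_exists_torsion W 3
      (exists_sha_ne_zero_of_congr_of_identityComponent_of_index_le_three_rat W W' θ hθ S hS hidxE hrank
        v₀ hv₀ hoff hcard hcard' M C hC x₀ y₀ a hcusp hns₀ hm h3 M' C' hC' x₀' y₀' a' hcusp' hns₀' hm' h3')
  have hlow : MissingLowerBoundAt W 3 :=
    missingLowerBoundAt_of_casselsTate_of_pow_dvd W 3 hCT hfin hs (k := 1)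
      (by rw [hv]; norm_num) (by simpa using hdvd)
  -- UPPER half: Kolyvagin
  have hup : MissingUpperBoundAt W 3 :=
    missingUpperBoundAt_of_padicValNat_shaOrder_le W 3 (k := 1)
      (padicValNat_shaOrder_le_of_kolyvagin W 3 hKo hB hK hH hP hnt (by norm_num) hρ hfin hI)
      hs (by rw [hv]; norm_num)
  exact bsdp_of_missingPPartAt W 3 hGZK (by omega) (missingPPartAt_of_lower_of_upper W 3 hlow hup)

end Summit.BirchSwinnertonDyer.Rank1Residual.GaloisImage.TwistedWitness

end
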